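import Literature.Computability.Complexity.ExtMonotoneGRankSupport
import Summits.PneNP.PneNP.Theorems.ConvexRankGatesBpmIsOneRankGate
import HarnessLib

/-!
# Crux `Capture` (stmt-PneNP-2659) — GRANK door algebra I: base change and the FULL-RANK normal form

Route PneNP/ConvexRankGates, crux `Summit.PneNP.PneNP.Theses.ConvexRankGates.Capture` (lead c9, 2026-08-17;
`--supports stmt-PneNP-2659`). Kernel form of the first lemma of idea card
`Cruxes/Capture/Ideas/generic-span-hull-shadow-collapse.md` (ideator 3, Prop `GRankIsShadow` of
`Cruxes/Capture/SketchIdeator3.lean`, unproved there): a generic-rank threshold gate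
`v ↦ [θ ≤ rank_{Frac F[X]} (K₀ + ∑_{vᵢ=1} Xᵢ Kᵢ)]` of ANY dimension `d` and threshold `θ` over a field `F`
is, over the purely transcendental extension `F' = Frac F[u, w]` (`u : θ × d`, `w : d × θ` fresh
indeterminates), the FULL-RANK gate of the `θ × θ` compressed data `U K₀ W, U Kᵢ W`
(`fullRank_form`): `θ ≤ rank (K₀ + ∑ Xᵢ Kᵢ) ↔ det (U (K₀ + ∑ Xᵢ Kᵢ) W) ≠ 0`, i.e. every GRANK gate is the
support shadow `v ↦ [killVars v (det P) ≠ 0]` of ONE square symbolic determinant (`fullRank_form_det`).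

Ingredients, all proved here:
* `killVars_map`, `symbolicPolyMatrix_map`, `le_rank_symbolicMatrix_map_iff` — GRANK data are stable under
  an injective change of the coefficient field (BASE CHANGE: the accepted set does not move);
* `symbolicPolyMatrix_conj` — constant matrices pass through `K ↦ (K₀ + ∑ Xᵢ Kᵢ)`;
* `det_compress_ne_zero_iff` — GENERIC COMPRESSION at the polynomial level: for a `d × d` matrix `Q` over
  `F[X]`, `det (U Q W) ≠ 0` (generic `U, W`) iff some `θ × θ` minor of `Q` is non-zero
  (`→`: over the fraction field `rank (U Q W) ≤ rank Q < θ`; `←`: specialise `u, w` to the 0/1 selector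
  matrices of the minor, `selector_mul_mul_selector`).

No new definitions; the generic matrices are written inline with `Matrix.of`. [folklore; Edmonds 1967 §5–§7 for
rank = largest non-vanishing minor; the compression trick is standard, e.g. Bürgisser 2000 §2.5]
-/

namespace Summit.PneNP.PneNP.Theorems.Capture.GRankAlgebra

set_option linter.dupNamespace false -- `Summit.PneNP.PneNP.…`: summit = sub-problem (D-0017)

open Literature.Computability.Complexity MvPolynomial Matrix

/-! ## Base change -/

section BaseChange

variable {F E : Type*} [Field F] [Field E] {n d : ℕ}

/-- Killing variables commutes with a change of the coefficient field. [folklore] -/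
theorem killVars_map (j : F →+* E) (v : Fin n → Bool) (p : MvPolynomial (Fin n) F) :
    killVars v (MvPolynomial.map j p) = MvPolynomial.map j (killVars v p) := by
  have h : (killVars (F := E) v).toRingHom.comp (MvPolynomial.map j) =
      (MvPolynomial.map j).comp (killVars (F := F) v).toRingHom := by
    refine MvPolynomial.ringHom_ext (fun a => ?_) (fun i => ?_)
    · simp only [RingHom.comp_apply, AlgHom.toRingHom_eq_coe, AlgHom.coe_toRingHom, map_C]
      rw [← MvPolynomial.algebraMap_eq, ← MvPolynomial.algebraMap_eq, AlgHom.commutes, AlgHom.commutes]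
      simp only [MvPolynomial.algebraMap_eq, map_C]
    · simp only [RingHom.comp_apply, AlgHom.toRingHom_eq_coe, AlgHom.coe_toRingHom, map_X, killVars_X]
      split_ifs <;> simp
  exact congrArg (fun φ : MvPolynomial (Fin n) F →+* MvPolynomial (Fin n) E => φ p) h

/-- The generic symbolic matrix of base-changed data is the base change of the generic symbolic matrix.
[folklore] -/
theorem symbolicPolyMatrix_map (j : F →+* E) (K₀ : Matrix (Fin d) (Fin d) F)
    (K : Fin n → Matrix (Fin d) (Fin d) F) :
    symbolicPolyMatrix (K₀.map j) (fun i => (K i).map j) =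
      (symbolicPolyMatrix K₀ K).map (MvPolynomial.map j) := by
  ext a b
  simp only [symbolicPolyMatrix, Matrix.add_apply, Matrix.map_apply, Matrix.sum_apply,
    Matrix.smul_apply, smul_eq_mul, map_add, map_sum, map_mul, map_X, map_C]

/-- **Base change does not move a GRANK gate**: over an extension field the same data accept the same
inputs. [folklore] -/
theorem le_rank_symbolicMatrix_map_iff (j : F →+* E) (K₀ : Matrix (Fin d) (Fin d) F)
    (K : Fin n → Matrix (Fin d) (Fin d) F) (v : Fin n → Bool) (θ : ℕ) :
    θ ≤ (symbolicMatrix (K₀.map j) (fun i => (K i).map j) v).rank ↔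
      θ ≤ (symbolicMatrix K₀ K v).rank := by
  rw [Literature.LinearAlgebra.Matrix.le_rank_iff_exists_det_submatrix_ne_zero,
    Literature.LinearAlgebra.Matrix.le_rank_iff_exists_det_submatrix_ne_zero]
  refine exists_congr fun r => exists_congr fun c => ?_
  rw [Ne, det_submatrix_symbolicMatrix_eq_zero_iff, Ne, det_submatrix_symbolicMatrix_eq_zero_iff,
    symbolicPolyMatrix_map, Matrix.submatrix_map, ← RingHom.mapMatrix_apply, ← RingHom.map_det,
    killVars_map, map_eq_zero_iff _ (MvPolynomial.map_injective j j.injective)]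

/-- Constant matrices pass through the symbolic matrix: the data `A K₀ B, A Kᵢ B` have generic symbolic
matrix `A (K₀ + ∑ Xᵢ Kᵢ) B`. [folklore] -/
theorem symbolicPolyMatrix_conj {θ : ℕ} (A : Matrix (Fin θ) (Fin d) F) (B : Matrix (Fin d) (Fin θ) F)
    (K₀ : Matrix (Fin d) (Fin d) F) (K : Fin n → Matrix (Fin d) (Fin d) F) :
    symbolicPolyMatrix (A * K₀ * B) (fun i => A * K i * B) =
      A.map (C : F →+* MvPolynomial (Fin n) F) * symbolicPolyMatrix K₀ K *
        B.map (C : F →+* MvPolynomial (Fin n) F) := by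
  simp only [symbolicPolyMatrix, Matrix.map_mul, Matrix.mul_add, Matrix.add_mul, Matrix.mul_sum,
    Matrix.sum_mul, Matrix.mul_smul, Matrix.smul_mul]

/-- Killing variables fixes constant matrices. [folklore] -/
theorem map_C_map_killVars {l m : Type*} (v : Fin n → Bool) (A : Matrix l m F) :
    (A.map (C : F →+* MvPolynomial (Fin n) F)).map (killVars v) =
      A.map (C : F →+* MvPolynomial (Fin n) F) := by
  ext a b
  simp only [Matrix.map_apply]
  rw [← MvPolynomial.algebraMap_eq, AlgHom.commutes]

end BaseChange

/-! ## Generic compression at the polynomial level -/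

section Compression

variable {S : Type*} [CommRing S] {d θ : ℕ}

/-- Selector matrices extract a submatrix: `(𝟙_{r a = i})_{a,i} · Q · (𝟙_{j = c b})_{j,b} = Q[r, c]`. [folklore] -/
theorem selector_mul_mul_selector (Q : Matrix (Fin d) (Fin d) S) (r c : Fin θ → Fin d) :
    (1 : Matrix (Fin d) (Fin d) S).submatrix r id * Q * (1 : Matrix (Fin d) (Fin d) S).submatrix id c =
      Q.submatrix r c := by
  refine Matrix.ext fun a b => ?_
  simp only [Matrix.mul_apply, Matrix.submatrix_apply, Matrix.one_apply, id, ite_mul, one_mul,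
    zero_mul, mul_ite, mul_one, mul_zero, Finset.sum_ite_eq, Finset.sum_ite_eq', Finset.mem_univ,
    if_true]

end Compression

section CompressionField

variable {F : Type*} [Field F] {n d θ : ℕ}

/-- Over a field: if every `θ × θ` minor of `Q` vanishes then `det (A Q B) = 0` for ALL `θ × d`, `d × θ`
matrices `A, B` (`rank (A Q B) ≤ rank Q < θ`). [folklore] -/
theorem det_mul_mul_eq_zero_of_minors {L : Type*} [Field L] (A : Matrix (Fin θ) (Fin d) L)
    (Q : Matrix (Fin d) (Fin d) L) (B : Matrix (Fin d) (Fin θ) L)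
    (h : ∀ r c : Fin θ → Fin d, (Q.submatrix r c).det = 0) : (A * Q * B).det = 0 := by
  cases θ with
  | zero => exact absurd (h Fin.elim0 Fin.elim0) (by simp)
  | succ s =>
    by_contra hne
    have h1 : s + 1 ≤ (A * Q * B).rank := (le_rank_iff_det_ne_zero_of_sq _).2 hne
    have h2 : (A * Q * B).rank ≤ Q.rank :=
      (Matrix.rank_mul_le_left _ _).trans (Matrix.rank_mul_le_right _ _)
    have h3 : Q.rank ≤ s := Literature.LinearAlgebra.Matrix.rank_le_of_det_submatrix_eq_zero Q h
    omega

/-- **Generic compression.** For a `d × d` matrix `Q` over `F[X]` and the GENERIC `θ × d` and `d × θ`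
matrices `U = (u_{a i})`, `W = (w_{j b})` (fresh indeterminates, coefficients enlarged to
`R₀ = F[u, w]`): `det (U Q W) ≠ 0` iff some `θ × θ` minor of `Q` is non-zero. [folklore] -/
theorem det_compress_ne_zero_iff (Q : Matrix (Fin d) (Fin d) (MvPolynomial (Fin n) F)) :
    ((Matrix.of fun (a : Fin θ) (i : Fin d) =>
          (C (X (Sum.inl (a, i)) : MvPolynomial ((Fin θ × Fin d) ⊕ (Fin d × Fin θ)) F) : MvPolynomial (Fin n) (MvPolynomial ((Fin θ × Fin d) ⊕ (Fin d × Fin θ)) F))) *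
        Q.map (MvPolynomial.map (algebraMap F (MvPolynomial ((Fin θ × Fin d) ⊕ (Fin d × Fin θ)) F))) *
        (Matrix.of fun (j : Fin d) (b : Fin θ) =>
          (C (X (Sum.inr (j, b)) : MvPolynomial ((Fin θ × Fin d) ⊕ (Fin d × Fin θ)) F) : MvPolynomial (Fin n) (MvPolynomial ((Fin θ × Fin d) ⊕ (Fin d × Fin θ)) F)))).det
        ≠ 0 ↔
      ∃ r c : Fin θ → Fin d, (Q.submatrix r c).det ≠ 0 := by
  set ι : MvPolynomial (Fin n) F →+* MvPolynomial (Fin n) (MvPolynomial ((Fin θ × Fin d) ⊕ (Fin d × Fin θ)) F) :=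
    MvPolynomial.map (algebraMap F (MvPolynomial ((Fin θ × Fin d) ⊕ (Fin d × Fin θ)) F))
  set U : Matrix (Fin θ) (Fin d) (MvPolynomial (Fin n) (MvPolynomial ((Fin θ × Fin d) ⊕ (Fin d × Fin θ)) F)) :=
    Matrix.of fun (a : Fin θ) (i : Fin d) =>
      (C (X (Sum.inl (a, i)) : MvPolynomial ((Fin θ × Fin d) ⊕ (Fin d × Fin θ)) F) : MvPolynomial (Fin n) (MvPolynomial ((Fin θ × Fin d) ⊕ (Fin d × Fin θ)) F))
  set W : Matrix (Fin d) (Fin θ) (MvPolynomial (Fin n) (MvPolynomial ((Fin θ × Fin d) ⊕ (Fin d × Fin θ)) F)) :=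
    Matrix.of fun (j : Fin d) (b : Fin θ) =>
      (C (X (Sum.inr (j, b)) : MvPolynomial ((Fin θ × Fin d) ⊕ (Fin d × Fin θ)) F) : MvPolynomial (Fin n) (MvPolynomial ((Fin θ × Fin d) ⊕ (Fin d × Fin θ)) F))
  constructor
  · -- `→`: all minors zero ⇒ over the fraction field `rank (U Q W) ≤ rank Q < θ` ⇒ `det = 0`
    intro hne
    by_contra hall
    push Not at hall
    apply hne
    have hφ : Function.Injective
        (algebraMap (MvPolynomial (Fin n) (MvPolynomial ((Fin θ × Fin d) ⊕ (Fin d × Fin θ)) F))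
          (FractionRing (MvPolynomial (Fin n) (MvPolynomial ((Fin θ × Fin d) ⊕ (Fin d × Fin θ)) F)))) :=
      IsFractionRing.injective _ _
    have hmin : ∀ r c : Fin θ → Fin d, (((Q.map ι).map (algebraMap (MvPolynomial (Fin n) (MvPolynomial ((Fin θ × Fin d) ⊕ (Fin d × Fin θ)) F))
          (FractionRing (MvPolynomial (Fin n) (MvPolynomial ((Fin θ × Fin d) ⊕ (Fin d × Fin θ)) F))))).submatrix r c).det = 0 := by
      intro r c
      rw [Matrix.submatrix_map, Matrix.submatrix_map, ← RingHom.mapMatrix_apply, ← RingHom.map_det,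
        ← RingHom.mapMatrix_apply, ← RingHom.map_det, hall r c, map_zero, map_zero]
    have h0 := det_mul_mul_eq_zero_of_minors (U.map (algebraMap _ _)) _ (W.map (algebraMap _ _)) hmin
    rwa [← Matrix.map_mul, ← Matrix.map_mul, ← RingHom.mapMatrix_apply, ← RingHom.map_det,
      map_eq_zero_iff _ hφ] at h0
  · -- `←`: specialise `u, w` to the selector matrices of a non-zero minor
    rintro ⟨r, c, hrc⟩ h0
    apply hrc
    set ev : MvPolynomial ((Fin θ × Fin d) ⊕ (Fin d × Fin θ)) F →+* F := MvPolynomial.eval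
      (Sum.elim (fun p : Fin θ × Fin d => if r p.1 = p.2 then (1 : F) else 0)
        (fun p : Fin d × Fin θ => if p.1 = c p.2 then (1 : F) else 0))
    set EV : MvPolynomial (Fin n) (MvPolynomial ((Fin θ × Fin d) ⊕ (Fin d × Fin θ)) F) →+* MvPolynomial (Fin n) F := MvPolynomial.map ev
    have hU : U.map EV = (1 : Matrix (Fin d) (Fin d) (MvPolynomial (Fin n) F)).submatrix r id := by
      refine Matrix.ext fun a i => ?_
      simp only [U, EV, ev, Matrix.map_apply, Matrix.of_apply, map_C, MvPolynomial.eval_X,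
        Sum.elim_inl, Matrix.submatrix_apply, id, Matrix.one_apply]
      split_ifs <;> simp
    have hW : W.map EV = (1 : Matrix (Fin d) (Fin d) (MvPolynomial (Fin n) F)).submatrix id c := by
      refine Matrix.ext fun j b => ?_
      simp only [W, EV, ev, Matrix.map_apply, Matrix.of_apply, map_C, MvPolynomial.eval_X,
        Sum.elim_inr, Matrix.submatrix_apply, id, Matrix.one_apply]
      split_ifs <;> simp
    have hid : ev.comp (algebraMap F (MvPolynomial ((Fin θ × Fin d) ⊕ (Fin d × Fin θ)) F)) = RingHom.id F :=
      RingHom.ext fun a => by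
        rw [RingHom.comp_apply, MvPolynomial.algebraMap_eq, RingHom.id_apply]
        simp only [ev, MvPolynomial.eval_C]
    have hQ : (Q.map ι).map EV = Q := by
      refine Matrix.ext fun a b => ?_
      simp only [Matrix.map_apply, ι, EV, MvPolynomial.map_map, hid, MvPolynomial.map_id]
    have := congrArg EV h0
    rw [RingHom.map_det, RingHom.mapMatrix_apply, Matrix.map_mul, Matrix.map_mul, hU, hW, hQ,
      selector_mul_mul_selector, map_zero] at this
    exact this

end CompressionField

/-! ## The full-rank normal form of a GRANK gate -/

section FullRank

variable {F : Type} [Field F] {n d : ℕ}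

/-- **Full-rank normal form (`GRankIsShadow`).** Any GRANK data `(d, θ, K₀, K)` over `F` have, over the purely
transcendental extension `F' = Frac F[u, w]`, `θ × θ` data `(U K₀ W, U Kᵢ W)` whose FULL-RANK gate accepts exactly
the same inputs: `θ ≤ rank (U K₀ W + ∑_{vᵢ=1} Xᵢ U Kᵢ W) ↔ θ ≤ rank (K₀ + ∑_{vᵢ=1} Xᵢ Kᵢ)`. [folklore] -/
theorem fullRank_form (θ : ℕ) (K₀ : Matrix (Fin d) (Fin d) F) (K : Fin n → Matrix (Fin d) (Fin d) F) :
    ∃ (K₀' : Matrix (Fin θ) (Fin θ) (FractionRing (MvPolynomial ((Fin θ × Fin d) ⊕ (Fin d × Fin θ)) F)))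
      (K' : Fin n → Matrix (Fin θ) (Fin θ) (FractionRing (MvPolynomial ((Fin θ × Fin d) ⊕ (Fin d × Fin θ)) F))),
      ∀ v : Fin n → Bool, θ ≤ (symbolicMatrix K₀' K' v).rank ↔ θ ≤ (symbolicMatrix K₀ K v).rank := by
  set κ : MvPolynomial ((Fin θ × Fin d) ⊕ (Fin d × Fin θ)) F →+* FractionRing (MvPolynomial ((Fin θ × Fin d) ⊕ (Fin d × Fin θ)) F) := algebraMap _ _
  have hκ : Function.Injective κ := IsFractionRing.injective _ _
  set α : F →+* FractionRing (MvPolynomial ((Fin θ × Fin d) ⊕ (Fin d × Fin θ)) F) := algebraMap F _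
  have hα : α = κ.comp (algebraMap F (MvPolynomial ((Fin θ × Fin d) ⊕ (Fin d × Fin θ)) F)) := IsScalarTower.algebraMap_eq F _ _
  set U' : Matrix (Fin θ) (Fin d) (FractionRing (MvPolynomial ((Fin θ × Fin d) ⊕ (Fin d × Fin θ)) F)) :=
    Matrix.of fun a i => κ (X (Sum.inl (a, i)))
  set W' : Matrix (Fin d) (Fin θ) (FractionRing (MvPolynomial ((Fin θ × Fin d) ⊕ (Fin d × Fin θ)) F)) :=
    Matrix.of fun j b => κ (X (Sum.inr (j, b)))
  refine ⟨U' * K₀.map α * W', fun i => U' * (K i).map α * W', fun v => ?_⟩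
  set Q : Matrix (Fin d) (Fin d) (MvPolynomial (Fin n) F) := (symbolicPolyMatrix K₀ K).map (killVars v)
    with hQ
  -- (1) the full-rank gate accepts iff the killed determinant `det (U'ᶜ · Q^α · W'ᶜ)` is non-zero
  have h1 : θ ≤ (symbolicMatrix (U' * K₀.map α * W') (fun i => U' * (K i).map α * W') v).rank ↔
      (U'.map (C : _ →+* MvPolynomial (Fin n) _) * Q.map (MvPolynomial.map α) *
        W'.map (C : _ →+* MvPolynomial (Fin n) _)).det ≠ 0 := by
    rw [le_rank_iff_det_ne_zero_of_sq, Ne, Ne,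
      show (symbolicMatrix (U' * K₀.map α * W') (fun i => U' * (K i).map α * W') v).det =
          ((symbolicMatrix (U' * K₀.map α * W') (fun i => U' * (K i).map α * W') v).submatrix id id).det by
        rw [Matrix.submatrix_id_id],
      det_submatrix_symbolicMatrix_eq_zero_iff, Matrix.submatrix_id_id, symbolicPolyMatrix_conj,
      ← AlgHom.coe_toRingHom, RingHom.map_det, RingHom.mapMatrix_apply, AlgHom.coe_toRingHom,
      Matrix.map_mul, Matrix.map_mul, map_C_map_killVars, map_C_map_killVars, symbolicPolyMatrix_map,
      show ((symbolicPolyMatrix K₀ K).map (MvPolynomial.map α)).map (killVars v) =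
        ((symbolicPolyMatrix K₀ K).map (killVars v)).map (MvPolynomial.map α) by
          rw [Matrix.map_map, Matrix.map_map]; congr 1; funext q; exact killVars_map α v q]
  -- (2) the old gate accepts iff some killed `θ × θ` minor is non-zero
  have h2 : θ ≤ (symbolicMatrix K₀ K v).rank ↔ ∃ r c : Fin θ → Fin d, (Q.submatrix r c).det ≠ 0 := by
    rw [Literature.LinearAlgebra.Matrix.le_rank_iff_exists_det_submatrix_ne_zero]
    refine exists_congr fun r => exists_congr fun c => ?_
    rw [Ne, Ne, det_submatrix_symbolicMatrix_eq_zero_iff, hQ, Matrix.submatrix_map,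
      ← AlgHom.coe_toRingHom, RingHom.map_det, RingHom.mapMatrix_apply]
  -- (3) the two compressed matrices agree after the (injective) change of coefficients `F[u,w] → F'`
  have h3 : U'.map (C : _ →+* MvPolynomial (Fin n) _) * Q.map (MvPolynomial.map α) *
      W'.map (C : _ →+* MvPolynomial (Fin n) _) =
      ((Matrix.of fun (a : Fin θ) (i : Fin d) =>
          (C (X (Sum.inl (a, i)) : MvPolynomial ((Fin θ × Fin d) ⊕ (Fin d × Fin θ)) F) : MvPolynomial (Fin n) (MvPolynomial ((Fin θ × Fin d) ⊕ (Fin d × Fin θ)) F))) *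
        Q.map (MvPolynomial.map (algebraMap F (MvPolynomial ((Fin θ × Fin d) ⊕ (Fin d × Fin θ)) F))) *
        (Matrix.of fun (j : Fin d) (b : Fin θ) =>
          (C (X (Sum.inr (j, b)) : MvPolynomial ((Fin θ × Fin d) ⊕ (Fin d × Fin θ)) F) :
            MvPolynomial (Fin n) (MvPolynomial ((Fin θ × Fin d) ⊕ (Fin d × Fin θ)) F)))).map (MvPolynomial.map κ) := by
    have hU' : U'.map (C : _ →+* MvPolynomial (Fin n) _) =
        (Matrix.of fun (a : Fin θ) (i : Fin d) =>
          (C (X (Sum.inl (a, i)) : MvPolynomial ((Fin θ × Fin d) ⊕ (Fin d × Fin θ)) F) :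
            MvPolynomial (Fin n) (MvPolynomial ((Fin θ × Fin d) ⊕ (Fin d × Fin θ)) F))).map (MvPolynomial.map κ) := by
      refine Matrix.ext fun a i => ?_
      simp only [U', Matrix.map_apply, Matrix.of_apply, map_C]
    have hW' : W'.map (C : _ →+* MvPolynomial (Fin n) _) =
        (Matrix.of fun (j : Fin d) (b : Fin θ) =>
          (C (X (Sum.inr (j, b)) : MvPolynomial ((Fin θ × Fin d) ⊕ (Fin d × Fin θ)) F) :
            MvPolynomial (Fin n) (MvPolynomial ((Fin θ × Fin d) ⊕ (Fin d × Fin θ)) F))).map (MvPolynomial.map κ) := by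
      refine Matrix.ext fun j b => ?_
      simp only [W', Matrix.map_apply, Matrix.of_apply, map_C]
    have hQ' : Q.map (MvPolynomial.map α) =
        (Q.map (MvPolynomial.map (algebraMap F (MvPolynomial ((Fin θ × Fin d) ⊕ (Fin d × Fin θ)) F)))).map (MvPolynomial.map κ) := by
      refine Matrix.ext fun a b => ?_
      simp only [Matrix.map_apply, MvPolynomial.map_map, ← hα]
    rw [Matrix.map_mul, Matrix.map_mul, hU', hW', hQ']
  refine h1.trans (Iff.trans ?_ ((det_compress_ne_zero_iff (θ := θ) Q).trans h2.symm))
  rw [h3, ← RingHom.mapMatrix_apply, ← RingHom.map_det, map_ne_zero_iff _ (MvPolynomial.map_injective κ hκ)]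

/-- The same normal form with the acceptance condition spelled as a non-vanishing determinant: every GRANK gate
is the support shadow of ONE square symbolic determinant. [folklore] -/
theorem fullRank_form_det (θ : ℕ) (K₀ : Matrix (Fin d) (Fin d) F) (K : Fin n → Matrix (Fin d) (Fin d) F) :
    ∃ (K₀' : Matrix (Fin θ) (Fin θ) (FractionRing (MvPolynomial ((Fin θ × Fin d) ⊕ (Fin d × Fin θ)) F)))
      (K' : Fin n → Matrix (Fin θ) (Fin θ) (FractionRing (MvPolynomial ((Fin θ × Fin d) ⊕ (Fin d × Fin θ)) F))),
      ∀ v : Fin n → Bool,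
        θ ≤ (symbolicMatrix K₀ K v).rank ↔ killVars v (symbolicPolyMatrix K₀' K').det ≠ 0 := by
  obtain ⟨K₀', K', h⟩ := fullRank_form θ K₀ K
  refine ⟨K₀', K', fun v => ?_⟩
  rw [← h v, le_rank_iff_det_ne_zero_of_sq, Ne, Ne,
    show (symbolicMatrix K₀' K' v).det = ((symbolicMatrix K₀' K' v).submatrix id id).det by
      rw [Matrix.submatrix_id_id],
    det_submatrix_symbolicMatrix_eq_zero_iff, Matrix.submatrix_id_id]

/-- **Gate-level corollary.** A GRANK gate of size parameter `s` (any field, dimension `d ≤ s`, threshold `θ`)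
is a GRANK gate given by SQUARE data of dimension `min θ (d+1) ≤ s + 1`... stated in the useful form: if
`θ ≤ s` then the gate is `IsGRankGate s` with full-rank data of dimension exactly `θ`; in general a gate with
`θ > d` is the constant `false`, which is the full-rank gate of the `1 × 1` zero data. [folklore] -/
theorem isGRankGate_fullRank {s : ℕ} {g : GateFn} (h : IsGRankGate s g) :
    ∃ (F' : Type) (_ : Field F') (θ : ℕ), θ ≤ s + 1 ∧ ∃ (K₀' : Matrix (Fin θ) (Fin θ) F')
      (K' : Fin g.1 → Matrix (Fin θ) (Fin θ) F'),
      ∀ v : Fin g.1 → Bool, g.2 v = true ↔ θ ≤ (symbolicMatrix K₀' K' v).rank := by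
  obtain ⟨F₀, _, d, θ, hd, K₀, K, hg⟩ := h
  by_cases hθ : θ ≤ d
  · obtain ⟨K₀', K', h'⟩ := fullRank_form θ K₀ K
    exact ⟨_, inferInstance, θ, by omega, K₀', K', fun v => by rw [hg v, h' v]⟩
  · -- `θ > d`: the gate never accepts; use the `1 × 1` zero data
    refine ⟨F₀, inferInstance, 1, by omega, 0, fun _ => 0, fun v => ?_⟩
    rw [hg v]
    have h1 : (symbolicMatrix K₀ K v).rank ≤ d := Matrix.rank_le_width (symbolicMatrix K₀ K v)
    have h2 : (symbolicMatrix (0 : Matrix (Fin 1) (Fin 1) F₀) (fun _ : Fin g.1 => 0) v).rank = 0 := by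
      have : symbolicMatrix (0 : Matrix (Fin 1) (Fin 1) F₀) (fun _ : Fin g.1 => 0) v = 0 := by
        ext a b
        simp [symbolicMatrix]
      rw [this, Matrix.rank_zero]
    constructor
    · intro h; omega
    · intro h; rw [h2] at h; omega

end FullRank

/-! ## Registered form (stub `grank_fullRank_normalForm` of crux stmt-PneNP-2659) -/

/-- **GRANK full-rank normal form, closed statement** (the registered stub): for every field `F` and GRANK data
`(d, θ, K₀, K)` there are `θ × θ` data over `Frac F[u, w]` whose full-rank gate accepts exactly the same inputs.
[folklore] -/
theorem grank_fullRank_normalForm : ∀ (F : Type) [Field F] (n d θ : ℕ) (K₀ : Matrix (Fin d) (Fin d) F)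
    (K : Fin n → Matrix (Fin d) (Fin d) F),
    ∃ (K₀' : Matrix (Fin θ) (Fin θ) (FractionRing (MvPolynomial ((Fin θ × Fin d) ⊕ (Fin d × Fin θ)) F)))
      (K' : Fin n → Matrix (Fin θ) (Fin θ) (FractionRing (MvPolynomial ((Fin θ × Fin d) ⊕ (Fin d × Fin θ)) F))),
      ∀ v : Fin n → Bool, (θ ≤ (symbolicMatrix K₀' K' v).rank ↔ θ ≤ (symbolicMatrix K₀ K v).rank) :=
  fun _ _ _ _ θ K₀ K => fullRank_form θ K₀ K

end Summit.PneNP.PneNP.Theorems.Capture.GRankAlgebra
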